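import Mathlib
import HarnessLib
import Summits.Ventures.LatticeQCDFlow.Exactness.SUNLeapfrogHMCUniformCertificates
import Summits.Ventures.LatticeQCDFlow.Exactness.SUNJitteredHMCMeasurableLabels
import Summits.Ventures.LatticeQCDFlow.Exactness.UniformJitterLaw

/-!
# `tau_jitter = 0` IS the default fixed-step kernel: the jittered engine HMC at the point-mass law equals `wilsonLeapfrogHMC`

HONEST FRAMING: exact (Metropolis-corrected) sampling algorithms for lattice gauge theory;
figures of merit are autocorrelation/cost numbers at stated couplings and volumes; no
continuum-physics claim.

Venture `LatticeQCDFlow` (cell pub-lqcd), topic `Exactness`, FANOUT row 9 (eng-latcore, GEN-24).  NEW WORK of the cell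
over GEN-24's `SUNJitteredHMCMeasurableLabels.lean` (`wilsonJitterHMCL`, `wilsonJitterHMCL_apply`),
`SUNLeapfrogHMCUniformCertificates.lean` (`wilsonLeapfrogHMC`) and `UniformJitterLaw.lean` (`uniformJitterLaw_zero_right`).
Nothing is cited as a fact; no number is claimed.  A consistency check of the typed dictionary: the engine's
`trajectory(τ, nstep, tau_jitter = 0)` draws the length from `δ_τ`, and the typed jittered kernel at `δ_τ` — equivalently
at `uniformJitterLaw τ 0` — is literally the typed fixed-step kernel, so every GEN-22…24 statement about
`wilsonJitterHMCL … η` specialises to the default engine path and conversely.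

* **`wilsonJitterHMCL_dirac`** — `wilsonJitterHMCL N d L β nstep (dirac τ) = wilsonLeapfrogHMC N d L β nstep τ`.
* **`wilsonJitterHMCL_uniformJitterLaw_zero`** — the same with `uniformJitterLaw τ 0` (the code's `tau_jitter = 0`).
-/

noncomputable section

namespace Summit.Ventures.LatticeQCDFlow.Exactness

open MeasureTheory ProbabilityTheory ProbabilityTheory.Kernel Set Function
open Literature.MathematicalPhysics.QuantumFieldTheory
open Literature.MathematicalPhysics.QuantumLattice (fundamentalRep continuous_fundamentalRep)
open scoped ENNReal

set_option backward.isDefEq.respectTransparency false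

variable {N d L : ℕ} [NeZero L]

/-- **NO JITTER IS THE POINT-MASS LAW**: the jittered engine kernel at `δ_τ` is the default fixed-step kernel. -/
theorem wilsonJitterHMCL_dirac (β : ℝ) (nstep : ℕ) (τ : ℝ) :
    wilsonJitterHMCL N d L β nstep (Measure.dirac τ) = wilsonLeapfrogHMC N d L β nstep τ := by
  refine Kernel.ext fun U => Measure.ext fun A hA => ?_
  rw [wilsonJitterHMCL_apply (N := N) (d := d) (L := L) β nstep (Measure.dirac τ) U hA, lintegral_dirac]
  rfl

/-- **`tau_jitter = 0`**: the jittered engine kernel at the code's law `uniformJitterLaw τ 0` is the default fixed-step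
kernel `wilsonLeapfrogHMC N d L β nstep τ`. -/
theorem wilsonJitterHMCL_uniformJitterLaw_zero (β : ℝ) (nstep : ℕ) (τ : ℝ) :
    wilsonJitterHMCL N d L β nstep (uniformJitterLaw τ 0) = wilsonLeapfrogHMC N d L β nstep τ := by
  rw [uniformJitterLaw_zero_right]
  exact wilsonJitterHMCL_dirac β nstep τ

end Summit.Ventures.LatticeQCDFlow.Exactness
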